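import Literature.NumberTheory.DiophantineGeometry.Conductor
import Literature.NumberTheory.DiophantineGeometry.ConductorExponentLeTwoProofs
import Literature.NumberTheory.DiophantineGeometry.TateAlgorithmPerfectField
import Literature.NumberTheory.DiophantineGeometry.TateAlgorithmOrdDiscriminant
import Literature.NumberTheory.DiophantineGeometry.MinimalDiscriminantProofs
import HarnessLib

/-!
# The conductor exponent vanishes exactly at the places of good reduction

Companion proof file of `Literature.NumberTheory.DiophantineGeometry.Conductor`: discharge of the
named fact `WeierstrassCurve.conductorExponent_eq_zero_iff` (Silverman ATAEC IV.10.2(a),(b):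
`f(E/K) = 0` iff `E` has good reduction).

In this library the conductor exponent of `W / K` at a finite place `v` is *defined* by Ogg's
formula `f_v = ord_v (Δ_min) + 1 − m_v` (Silverman ATAEC IV.11.1), `m_v` being the number of
components read off from the Kodaira symbol returned by Tate's algorithm
(`WeierstrassCurve.kodairaSymbolOfMinimal`, Silverman ATAEC IV.9.4) run on the integral local
minimal model `M = W.localMinimalIntegralModel v` over `O_v`. For this definition the statement
`f_v = 0 ↔ good reduction` is the following case analysis along the local trichotomy
(Silverman ATAEC IV.9.4 with Table 4.1, rows `m` and `v(Δ)`; IV.10.2(b)):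

* good reduction: `ord_v (Δ_min) = 0` (`WeierstrassCurve.ordMinimalDiscriminant_eq_zero_iff_holds`)
  and Step 1 returns `I₀`, `m_v = 1` (`WeierstrassCurve.isGood_kodairaSymbolAt_iff_holds`), so
  `f_v = 0 + 1 − 1 = 0`;
* multiplicative reduction: Step 2 returns `Iₙ` with `n = ord_v (Δ_min) ≥ 1`
  (`WeierstrassCurve.kodairaSymbolAt_eq_I_iff_holds`), so `m_v = n` and `f_v = 1 ≠ 0`;
* additive reduction (perfect residue field, the standing hypothesis of Tate's algorithm):
  `m_v + 1 ≤ ord_v (Δ_min)` by the divisibilities accumulated along Steps 3–10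
  (`Literature.NumberTheory.DiophantineGeometry.TateAlgorithm.numComponents_add_one_le_addVal_Δ_toNat`, file
  `TateAlgorithmPerfectField`; Step 11 is excluded for the minimal model by
  `WeierstrassCurve.localMinimalIntegralModel_step11`), so `f_v ≥ 2 ≠ 0`.

## References

* J. H. Silverman, *Advanced Topics in the Arithmetic of Elliptic Curves*, GTM 151, Springer 1994,
  §IV.9 (Tate's algorithm 9.4 and Table 4.1), §IV.10 (Thm. 10.2(a),(b)), §IV.11 (Ogg's formula
  11.1).
* J. H. Silverman, *The Arithmetic of Elliptic Curves*, GTM 106, 2nd ed. 2009, VII.5.1.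
-/

open IsDedekindDomain

namespace WeierstrassCurve

open Literature.NumberTheory.DiophantineGeometry Literature.NumberTheory.DiophantineGeometry.TateAlgorithm

section Local

variable {A : Type*} [CommRing A] [IsDedekindDomain A] {K : Type*} [Field K]
  [Algebra A K] [IsFractionRing A K] (v : HeightOneSpectrum A) (W : WeierstrassCurve K)

/-- **Discharge of `WeierstrassCurve.conductorExponent_eq_zero_iff`** (Silverman ATAEC
IV.10.2(a),(b); AEC VII.5.1(a)): for an elliptic `W / K` and a finite place `v` whose completed
local ring `O_v` has perfect residue field, `f_v = 0 ↔ W` has good reduction at `v`, where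
`f_v = ord_v (Δ_min) + 1 − m_v` is Ogg's formula (ATAEC IV.11.1).
(`←`) good reduction gives `ord_v (Δ_min) = 0` and Kodaira type `I₀`, `m_v = 1`.
(`→`) by the local trichotomy: multiplicative reduction gives type `Iₙ`, `m_v = n = ord_v (Δ_min)`,
so `f_v = 1`; additive reduction gives `m_v + 1 ≤ ord_v (Δ_min)` (Tate's algorithm IV.9.4,
Table 4.1: `v(Δ) ≥ 2, 3, 4, 6, n + 6, 8, 9, 10` for `II, III, IV, I₀*, Iₙ*, IV*, III*, II*`),
so `f_v ≥ 2`. [cite: Silverman1994, IV.10.2(a),(b)] -/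
theorem conductorExponent_eq_zero_iff_holds : conductorExponent_eq_zero_iff v W := by
  intro _ _
  constructor
  · intro hf
    rcases hasGoodReductionAt_or_hasMultiplicativeReductionAt_or_hasAdditiveReductionAt v W with
      hg | hm | ha
    · exact hg
    · -- multiplicative reduction: type `Iₙ`, `m = n = ord Δ_min ≥ 1`, so `f = 1`
      exfalso
      have hn : W.ordMinimalDiscriminant v ≠ 0 := fun h0 ↦
        hm.not_hasGoodReductionAt ((ordMinimalDiscriminant_eq_zero_iff_holds v W).mp h0)
      have hK : W.kodairaSymbolAt v = .I (W.ordMinimalDiscriminant v) :=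
        (kodairaSymbolAt_eq_I_iff_holds v W hn).mpr ⟨hm, rfl⟩
      unfold conductorExponent numComponentsAt at hf
      rw [hK, KodairaSymbol.numComponents_I_of_ne_zero hn] at hf
      omega
    · -- additive reduction: `m + 1 ≤ ord Δ_min` (Tate's algorithm, perfect residue field)
      exfalso
      obtain ⟨hΔ, hc₄⟩ := (hasAdditiveReductionAt_iff_mem v W).mp ha
      have hle := numComponents_add_one_le_addVal_Δ_toNat (W.localMinimalIntegralModel v)
        (localMinimalIntegralModel_Δ_ne_zero v W) hΔ hc₄ (localMinimalIntegralModel_step11 v W)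
      unfold conductorExponent numComponentsAt ordMinimalDiscriminant at hf
      rw [kodairaSymbolAt_def] at hf
      omega
  · -- good reduction: `ord Δ_min = 0`, type `I₀`, `m = 1`
    intro hg
    have hK : W.kodairaSymbolAt v = .I 0 := (isGood_kodairaSymbolAt_iff_holds v W).mpr hg
    have hΔ : W.ordMinimalDiscriminant v = 0 :=
      (ordMinimalDiscriminant_eq_zero_iff_holds v W).mpr hg
    unfold conductorExponent numComponentsAt
    rw [hK, hΔ, KodairaSymbol.numComponents_I_zero]

end Local

end WeierstrassCurve
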